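import Summits.KontsevichZagierPeriods.KontsevichZagierPeriods.Theses.IsogenyCertificates
import Literature.NumberTheory.Transcendental.KZCalculus
import Literature.NumberTheory.EllipticCurves.RealLatticePeriod
import Literature.NumberTheory.EllipticCurves.LatticeInclusionDescentProofs
import Literature.NumberTheory.EllipticCurves.WeierstrassPMultiplication
import Literature.NumberTheory.EllipticCurves.RealLatticePeriodProofs

/-!
# `RealPeriodSectorComplete` (stmt-KontsevichZagierPeriods-5381, route IsogenyCertificates) —
line `period-ratio-branch-cov`, stub `stub_dividedIsogenyCurve`

Let `Λ, Λ'` be the real period lattices of `y² = x³ + Ax + B`, `y² = x³ + A'x + B'`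
(`A, B, A', B' ∈ ℤ`; invariants `g₂ = -4A, g₃ = -4B`, …), with least positive real periods
`Ω = Ω(Λ)`, `Ω' = Ω(Λ') = βΩ`, `β ∈ ℚ_{>0}`, and let `Φ` be the real branch
`x = ℘_Λ(z) ↦ ℘_{Λ'}(βz)`, `z ∈ (0, Ω/2)`, on `(e, ∞)`. GIVEN the transcendence input
"two lattices with algebraic invariants sharing a non-zero vector are commensurable" (the first
hypothesis; Schneider 1937), the graph of `Φ` lies on an algebraic curve `F = 0`,
`F ∈ ℚ[x, y]`, all of whose vertical fibres `{y | F(x, y) = 0}` are finite.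

Proof. `Ω ∈ Λ ∩ β⁻¹Λ'`, so `mΛ ⊆ β⁻¹Λ'` for some `m ≥ 1`, i.e. `Λ ⊆ Λ'' := (mβ)⁻¹Λ'`; all four
invariants of `Λ, Λ''` are rational, so `℘_{Λ''}·Q₀(℘_Λ) = P₀(℘_Λ)` off `Λ''` with coprime
`P₀, Q₀ ∈ ℚ[X]` (`PeriodPair.exists_rat_polynomial_weierstrassP_mul_eval_eq_of_le`, the
`ℚ`-rationality of the isogeny); `℘_{Λ''}(z) = (mβ)²·℘_{Λ'}(mβz)` (homogeneity) and
`℘_{Λ'}(m u)·ΨSq_m(℘_{Λ'} u) = Φ_m(℘_{Λ'} u)` (division polynomials of the `ℚ`-model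
`⟨0,0,0,A',B'⟩` of `E_{Λ'}`, `PeriodPair.weierstrassP_int_mul_mul_ΨSq`). With `u = βz`,
`x = ℘_Λ(z)`, `y = Φ(x) = ℘_{Λ'}(u)` this reads `F(x, y) = 0` for
`F = P₀(X₀)·ΨSq_m(X₁) − (mβ)²·Q₀(X₀)·Φ_m(X₁)`, as long as `mβz ∉ Λ'`; at the
exceptional `z` (`mβz ∈ Λ'`, i.e. `z ∈ Λ'' ∖ Λ`) both `ΨSq_m(y) = 0` (torsion) and `Q₀(x) = 0`
(`℘_{Λ''}` has a pole at `z` while `P₀(℘_Λ)` stays finite), so `F(x, y) = 0` again — the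
continuity hypothesis on `Φ` is not needed. Finite fibres: for fixed `x` the polynomial
`y ↦ F(x, y)` is `P₀(x)·ΨSq_m − (mβ)²Q₀(x)·Φ_m` with `Φ_m` monic of degree `m²` and
`deg ΨSq_m ≤ m² − 1`; it is non-zero whether `Q₀(x) ≠ 0` (degree `m²`) or `Q₀(x) = 0` (then
`P₀(x) ≠ 0` by coprimality and `ΨSq_m ≠ 0`).

References: J. H. Silverman, *The Arithmetic of Elliptic Curves* (2009), Thm. VI.4.1,
Exercise 3.7; D. A. Cox, *Primes of the form x² + ny²* (2013), §10.C.
-/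

noncomputable section

open MeasureTheory Set Filter
open scoped PeriodPair Topology
open Literature.NumberTheory.Transcendental
open Literature.NumberTheory.Transcendental.KZ
open Polynomial

namespace Summit.KontsevichZagierPeriods.IsogenyCertificates.RealPeriodSectorCompleteStubs.DividedIsogenyCurve

/-! ### A pole of `℘_{Λ'}` off `Λ` kills the denominator of the transformation -/

/-- If `℘_{Λ'}(z)·Q(℘_Λ z) = P(℘_Λ z)` for all `z ∉ Λ'`, then `Q(℘_Λ z₀) = 0` at every
`z₀ ∈ Λ' ∖ Λ`: otherwise `℘_{Λ'} = P(℘_Λ)/Q(℘_Λ)` would stay bounded near its pole `z₀`.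
[folklore] -/
theorem eval_weierstrassP_eq_zero_of_mem_lattice {L L' : PeriodPair} {P Q : ℂ[X]}
    (hPQ : ∀ z ∉ L'.lattice, ℘[L'] z * Q.eval (℘[L] z) = P.eval (℘[L] z))
    {z₀ : ℂ} (h₀' : z₀ ∈ L'.lattice) (h₀ : z₀ ∉ L.lattice) : Q.eval (℘[L] z₀) = 0 := by
  by_contra hq
  have h℘c : ContinuousAt ℘[L] z₀ := (L.analyticOnNhd_weierstrassP z₀ h₀).continuousAt
  have hcP : ContinuousAt (fun w ↦ P.eval (℘[L] w)) z₀ :=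
    ContinuousAt.comp (g := fun x ↦ P.eval x) P.continuous.continuousAt h℘c
  have hcQ : ContinuousAt (fun w ↦ Q.eval (℘[L] w)) z₀ :=
    ContinuousAt.comp (g := fun x ↦ Q.eval x) Q.continuous.continuousAt h℘c
  have hlim : Tendsto (fun w ↦ P.eval (℘[L] w) / Q.eval (℘[L] w)) (𝓝[≠] z₀)
      (𝓝 (P.eval (℘[L] z₀) / Q.eval (℘[L] z₀))) :=
    (hcP.div hcQ hq).tendsto.mono_left nhdsWithin_le_nhds
  have hev : ∀ᶠ w in 𝓝[≠] z₀, w ∉ L'.lattice := by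
    filter_upwards [mem_nhdsWithin_of_mem_nhds (L'.compl_lattice_sdiff_singleton_mem_nhds z₀),
      self_mem_nhdsWithin] with w hw hw0
    exact fun hwΛ ↦ hw ⟨hwΛ, hw0⟩
  have hevQ : ∀ᶠ w in 𝓝[≠] z₀, Q.eval (℘[L] w) ≠ 0 :=
    (hcQ.tendsto.mono_left nhdsWithin_le_nhds).eventually_ne hq
  have h5 : Tendsto ℘[L'] (𝓝[≠] z₀) (𝓝 (P.eval (℘[L] z₀) / Q.eval (℘[L] z₀))) := by
    refine hlim.congr' ?_
    filter_upwards [hev, hevQ] with w hw hwq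
    rw [← hPQ w hw, mul_div_cancel_right₀ _ hwq]
  have h6 : Tendsto (fun w ↦ ‖℘[L'] w‖) (𝓝[≠] z₀) atTop :=
    tendsto_norm_cobounded_atTop.comp (L'.tendsto_weierstrassP_cobounded h₀')
  exact h5.norm.not_tendsto (disjoint_nhds_atTop _) h6

/-! ### Polynomial bookkeeping for `F = P₀(X₀)·S(X₁) − k·Q₀(X₀)·T(X₁)` -/

/-- Casting a real evaluation of a rational polynomial into `ℂ`. [folklore] -/
theorem ofReal_aeval (x : ℝ) (p : ℚ[X]) : ((aeval x p : ℝ) : ℂ) = aeval (x : ℂ) p := by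
  rw [← Complex.coe_algebraMap, aeval_algebraMap_apply]

/-- Evaluation of `F = P₀(X₀)·S(X₁) − k·Q₀(X₀)·T(X₁)` at a real point `(x, y)`. [folklore] -/
theorem aeval_F (P₀ Q₀ S T : ℚ[X]) (k : ℚ) (x y : ℝ) :
    MvPolynomial.aeval (![x, y] : Fin 2 → ℝ)
      (P₀.toMvPolynomial 0 * S.toMvPolynomial 1 -
        MvPolynomial.C k * Q₀.toMvPolynomial 0 * T.toMvPolynomial 1) =
    aeval x P₀ * aeval y S - (k : ℝ) * aeval x Q₀ * aeval y T := by
  simp only [map_sub, map_mul, MvPolynomial.aeval_C, MvPolynomial.aeval_toMvPolynomial,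
    Matrix.cons_val_zero, Matrix.cons_val_one, eq_ratCast]

/-- The same evaluation, cast into `ℂ`. [folklore] -/
theorem ofReal_aeval_F (P₀ Q₀ S T : ℚ[X]) (k : ℚ) (x y : ℝ) :
    ((MvPolynomial.aeval (![x, y] : Fin 2 → ℝ)
      (P₀.toMvPolynomial 0 * S.toMvPolynomial 1 -
        MvPolynomial.C k * Q₀.toMvPolynomial 0 * T.toMvPolynomial 1) : ℝ) : ℂ) =
    aeval (x : ℂ) P₀ * aeval (y : ℂ) S - (k : ℂ) * aeval (x : ℂ) Q₀ * aeval (y : ℂ) T := by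
  rw [aeval_F]
  push_cast
  simp only [ofReal_aeval]

/-- **Finite vertical fibres.** For coprime `P₀, Q₀ ∈ ℚ[X]`, `k ≠ 0`, `n ≠ 0` and a Weierstrass
curve `W/ℚ`, every fibre `{y | P₀(x)·ΨSq_n(y) − k·Q₀(x)·Φ_n(y) = 0}` (`x ∈ ℝ`) is finite:
`Φ_n` is monic of degree `n²` and `deg ΨSq_n ≤ n² − 1` (Silverman, *AEC*, Exercise 3.7(b)), so
the `y`-polynomial has degree `n²` if `Q₀(x) ≠ 0`, and equals `P₀(x)·ΨSq_n ≠ 0` if `Q₀(x) = 0`.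
[folklore] -/
theorem finite_fibre (W : WeierstrassCurve ℚ) {P₀ Q₀ : ℚ[X]} (hcop : IsCoprime P₀ Q₀) {k : ℚ}
    (hk : k ≠ 0) {n : ℤ} (hn : n ≠ 0) (x : ℝ) :
    {y : ℝ | MvPolynomial.aeval (![x, y] : Fin 2 → ℝ)
      (P₀.toMvPolynomial 0 * (W.ΨSq n).toMvPolynomial 1 -
        MvPolynomial.C k * Q₀.toMvPolynomial 0 * (W.Φ n).toMvPolynomial 1) = 0}.Finite := by
  set W' : WeierstrassCurve ℝ := W.map (algebraMap ℚ ℝ) with hW'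
  set a : ℝ := aeval x P₀ with ha
  set b : ℝ := (k : ℝ) * aeval x Q₀ with hb
  set G : ℝ[X] := C a * W'.ΨSq n - C b * W'.Φ n with hG
  have hGeval : ∀ y : ℝ, MvPolynomial.aeval (![x, y] : Fin 2 → ℝ)
      (P₀.toMvPolynomial 0 * (W.ΨSq n).toMvPolynomial 1 -
        MvPolynomial.C k * Q₀.toMvPolynomial 0 * (W.Φ n).toMvPolynomial 1) = G.eval y := by
    intro y
    rw [aeval_F, hG, hW', WeierstrassCurve.map_ΨSq, WeierstrassCurve.map_Φ, eval_sub, eval_mul,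
      eval_mul, eval_C, eval_C, eval_map_algebraMap, eval_map_algebraMap]
  have hG0 : G ≠ 0 := by
    by_cases hq : aeval x Q₀ = 0
    · have ha0 : a ≠ 0 := by
        obtain ⟨s, t, hst⟩ := hcop
        have h1 := congrArg (aeval x) hst
        rw [map_add, map_mul, map_mul, hq, mul_zero, add_zero, map_one] at h1
        intro ha0
        rw [ha] at ha0
        rw [ha0, mul_zero] at h1
        exact zero_ne_one h1
      have hb0 : b = 0 := by rw [hb, hq, mul_zero]
      rw [hG, hb0, C_0, zero_mul, sub_zero]
      exact mul_ne_zero (C_ne_zero.mpr ha0) (W'.ΨSq_ne_zero (by exact_mod_cast hn))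
    · have hb0 : b ≠ 0 := mul_ne_zero (by exact_mod_cast hk) hq
      intro hG0
      have h1 : C b * W'.Φ n = C a * W'.ΨSq n := (sub_eq_zero.mp (hG ▸ hG0)).symm
      have h2 := congrArg natDegree h1
      rw [natDegree_C_mul hb0, W'.natDegree_Φ] at h2
      have h3 : (C a * W'.ΨSq n).natDegree ≤ n.natAbs ^ 2 - 1 :=
        (natDegree_C_mul_le _ _).trans (W'.natDegree_ΨSq_le n)
      have h4 : 1 ≤ n.natAbs ^ 2 := Nat.one_le_pow _ _ (Int.natAbs_pos.mpr hn)
      omega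
  refine (G.finite_setOf_isRoot hG0).subset fun y hy ↦ ?_
  simp only [Set.mem_setOf_eq] at hy ⊢
  rw [IsRoot.def, ← hGeval]
  exact hy

/-! ### The stub -/

/-- **Divided-isogeny curve through the graph of the uniformized branch.** Given the
transcendence input `H` (lattices with algebraic invariants sharing a non-zero vector are
commensurable), the real branch `Φ : ℘_Λ(z) ↦ ℘_{Λ'}(βz)` (`z ∈ (0, Ω/2)`, `Ω' = βΩ`) between the
real period lattices of `y² = x³ + Ax + B` and `y² = x³ + A'x + B'` satisfies `F(x, Φ x) = 0` on
`(e, ∞)` for a polynomial `F ∈ ℚ[x, y]` with finite vertical fibres, namely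
`F = P₀(x)·ΨSq_m(y) − (mβ)²·Q₀(x)·Φ_m(y)` where `℘_{(mβ)⁻¹Λ'} = (P₀/Q₀)(℘_Λ)` is the `ℚ`-rational
transformation of `Λ ⊆ (mβ)⁻¹Λ'` and `Φ_m, ΨSq_m` are the division polynomials of
`y² = x³ + A'x + B'` (see the module docstring for the proof). [folklore] -/
theorem stub_dividedIsogenyCurve : (∀ (L₁ L₂ : PeriodPair), IsAlgebraic ℚ L₁.g₂ → IsAlgebraic ℚ L₁.g₃ → IsAlgebraic ℚ L₂.g₂ → IsAlgebraic ℚ L₂.g₃ → (∃ ℓ : ℂ, ℓ ≠ 0 ∧ ℓ ∈ L₁.lattice ∧ ℓ ∈ L₂.lattice) → ∃ m : ℕ, 0 < m ∧ ∀ z ∈ L₁.lattice, (m : ℂ) * z ∈ L₂.lattice) → ∀ (A B A' B' : ℤ) (e : ℝ) (β : ℚ), 0 < β → ∀ (Φ : ℝ → ℝ) (L L' : PeriodPair), L.IsReal → L'.IsReal → L.g₂ = -4 * (A : ℂ) → L.g₃ = -4 * (B : ℂ) → L'.g₂ = -4 * (A' : ℂ) → L'.g₃ = -4 * (B' : ℂ)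 → L'.minRealPeriod = (β : ℝ) * L.minRealPeriod → (∀ x : ℝ, e < x → ∃ z : ℝ, 0 < z ∧ z < L.minRealPeriod / 2 ∧ ℘[L] (z : ℂ) = (x : ℂ) ∧ ℘[L'] ((β : ℂ) * (z : ℂ)) = (Φ x : ℂ)) → ContinuousOn Φ (Ioi e) → ∃ F : MvPolynomial (Fin 2) ℚ, (∀ x : ℝ, e < x → {y : ℝ | MvPolynomial.aeval (![x, y] : Fin 2 → ℝ) F = 0}.Finite) ∧ ∀ x : ℝ, e < x → MvPolynomial.aeval (![x, Φ x] : Fin 2 → ℝ) F = 0 := by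
  intro H A B A' B' e β hβ Φ L L' hL hL' hg₂ hg₃ hg₂' hg₃' hper hbranch _hcont
  -- basic facts
  have hΩ : 0 < L.minRealPeriod := hL.minRealPeriod_pos
  have hβ0 : (β : ℂ) ≠ 0 := by exact_mod_cast hβ.ne'
  have halg : ∀ q : ℚ, IsAlgebraic ℚ (q : ℂ) := fun q ↦ by
    simpa using isAlgebraic_algebraMap (R := ℚ) (A := ℂ) q
  -- Step 1: `Ω ∈ Λ ∩ β⁻¹Λ'`, so `mΛ ⊆ β⁻¹Λ'` by the transcendence input
  obtain ⟨L₂, hL₂⟩ : ∃ L₂ : PeriodPair, L₂ = L'.mulLeft ((β : ℂ)⁻¹) (inv_ne_zero hβ0) :=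
    ⟨_, rfl⟩
  have hΩ' : (β : ℂ) * (L.minRealPeriod : ℂ) ∈ L'.lattice := by
    have h1 := hL'.minRealPeriod_mem_lattice
    rw [hper] at h1
    push_cast at h1
    exact h1
  have hΩL₂ : (L.minRealPeriod : ℂ) ∈ L₂.lattice := by
    rw [hL₂, PeriodPair.mem_mulLeft_lattice, inv_inv]
    exact hΩ'
  have hA : IsAlgebraic ℚ L.g₂ := by
    rw [hg₂, show (-4 * (A : ℂ)) = ((-4 * A : ℚ) : ℂ) by push_cast; ring]
    exact halg _
  have hB : IsAlgebraic ℚ L.g₃ := by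
    rw [hg₃, show (-4 * (B : ℂ)) = ((-4 * B : ℚ) : ℂ) by push_cast; ring]
    exact halg _
  have hA₂ : IsAlgebraic ℚ L₂.g₂ := by
    rw [show L₂.g₂ = ((β ^ 4 * (-4 * A') : ℚ) : ℂ) by
      rw [hL₂, PeriodPair.g₂_mulLeft, inv_pow, inv_inv, hg₂']; push_cast; ring]
    exact halg _
  have hB₂ : IsAlgebraic ℚ L₂.g₃ := by
    rw [show L₂.g₃ = ((β ^ 6 * (-4 * B') : ℚ) : ℂ) by
      rw [hL₂, PeriodPair.g₃_mulLeft, inv_pow, inv_inv, hg₃']; push_cast; ring]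
    exact halg _
  obtain ⟨m, hm, hmul⟩ := H L L₂ hA hB hA₂ hB₂
    ⟨L.minRealPeriod, by exact_mod_cast hΩ.ne', hL.minRealPeriod_mem_lattice, hΩL₂⟩
  -- Step 2: `Λ ⊆ Λ'' := (mβ)⁻¹Λ'`, a lattice with rational invariants
  have hm0 : (m : ℂ) ≠ 0 := by exact_mod_cast hm.ne'
  have hmβ : (m : ℂ) * β ≠ 0 := mul_ne_zero hm0 hβ0
  obtain ⟨L'', hL''⟩ : ∃ L'' : PeriodPair, L'' = L'.mulLeft ((m : ℂ) * β)⁻¹ (inv_ne_zero hmβ) :=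
    ⟨_, rfl⟩
  have hmem'' : ∀ z : ℂ, z ∈ L''.lattice ↔ (m : ℂ) * β * z ∈ L'.lattice := by
    intro z
    rw [hL'', PeriodPair.mem_mulLeft_lattice, inv_inv]
  have hle : L.lattice ≤ L''.lattice := by
    intro z hz
    have h1 := hmul z hz
    rw [hL₂, PeriodPair.mem_mulLeft_lattice, inv_inv] at h1
    rw [hmem'', show (m : ℂ) * β * z = β * (m * z) by ring]
    exact h1
  have h℘'' : ∀ z : ℂ, ℘[L''] z = ((m : ℂ) * β) ^ 2 * ℘[L'] ((m : ℂ) * β * z) := by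
    intro z
    have h1 := PeriodPair.weierstrassP_mulLeft ((m : ℂ) * β)⁻¹ (inv_ne_zero hmβ) L'
      ((m : ℂ) * β * z)
    rw [inv_pow, inv_inv, ← mul_assoc, inv_mul_cancel₀ hmβ, one_mul] at h1
    rw [hL'']
    exact h1
  have hg₂'' : L''.g₂ = ((((m : ℚ) * β) ^ 4 * (-4 * A') : ℚ) : ℂ) := by
    rw [hL'', PeriodPair.g₂_mulLeft, inv_pow, inv_inv, hg₂']; push_cast; ring
  have hg₃'' : L''.g₃ = ((((m : ℚ) * β) ^ 6 * (-4 * B') : ℚ) : ℂ) := by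
    rw [hL'', PeriodPair.g₃_mulLeft, inv_pow, inv_inv, hg₃']; push_cast; ring
  -- Step 3: the `ℚ`-rational transformation `℘_{Λ''}·Q₀(℘_Λ) = P₀(℘_Λ)`
  obtain ⟨P₀, Q₀, -, hcop, -, hPQ⟩ := L.exists_rat_polynomial_weierstrassP_mul_eval_eq_of_le L''
    hle ⟨-4 * A, by rw [hg₂]; push_cast; ring⟩ ⟨-4 * B, by rw [hg₃]; push_cast; ring⟩
    ⟨_, hg₂''.symm⟩ ⟨_, hg₃''.symm⟩
  -- Step 4: the `ℚ`-model of `E_{Λ'}` and the polynomial `F`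
  set W : WeierstrassCurve ℚ := ⟨0, 0, 0, (A' : ℚ), (B' : ℚ)⟩ with hW
  have hWmap : W.map (algebraMap ℚ ℂ) = L'.curve :=
    PeriodPair.map_eq_curve (by rw [eq_ratCast, hg₂']; push_cast; ring)
      (by rw [eq_ratCast, hg₃']; push_cast; ring)
  have hmZ : ((m : ℤ) : ℂ) = (m : ℂ) := by push_cast; rfl
  have hmne : (m : ℤ) ≠ 0 := by exact_mod_cast hm.ne'
  set k : ℚ := ((m : ℚ) * β) ^ 2 with hk
  have hk0 : k ≠ 0 := pow_ne_zero _ (mul_ne_zero (by exact_mod_cast hm.ne') hβ.ne')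
  have hkC : (k : ℂ) = ((m : ℂ) * β) ^ 2 := by rw [hk]; push_cast; rfl
  refine ⟨P₀.toMvPolynomial 0 * (W.ΨSq m).toMvPolynomial 1 -
      MvPolynomial.C k * Q₀.toMvPolynomial 0 * (W.Φ m).toMvPolynomial 1,
    fun x _ ↦ finite_fibre W hcop hk0 hmne x, fun x hx ↦ ?_⟩
  -- Step 5: `F(x, Φ x) = 0`
  obtain ⟨z, hz0, hzΩ, hxz, hyz⟩ := hbranch x hx
  have hzΛ : (z : ℂ) ∉ L.lattice := hL.ofReal_notMem_lattice hz0 (by linarith)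
  have huΛ' : (β : ℂ) * (z : ℂ) ∉ L'.lattice := by
    have hβR : (0 : ℝ) < β := by exact_mod_cast hβ
    have h1 := hL'.ofReal_notMem_lattice (t := (β : ℝ) * z) (mul_pos hβR hz0)
      (by rw [hper]; nlinarith)
    push_cast at h1
    exact h1
  have key : aeval (x : ℂ) P₀ * aeval ((Φ x : ℝ) : ℂ) (W.ΨSq m) -
      (k : ℂ) * aeval (x : ℂ) Q₀ * aeval ((Φ x : ℝ) : ℂ) (W.Φ m) = 0 := by
    rw [← hxz, ← hyz, PeriodPair.aeval_ΨSq_of_map_eq_curve hWmap,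
      PeriodPair.aeval_Φ_of_map_eq_curve hWmap, ← eval_map_algebraMap, ← eval_map_algebraMap,
      hkC]
    by_cases hz'' : (z : ℂ) ∈ L''.lattice
    · -- exceptional point: `Q₀(x) = 0` and `ΨSq_m(y) = 0`
      have hQ : (Q₀.map (algebraMap ℚ ℂ)).eval (℘[L] z) = 0 :=
        eval_weierstrassP_eq_zero_of_mem_lattice hPQ hz'' hzΛ
      have hmu : ((m : ℤ) : ℂ) * ((β : ℂ) * (z : ℂ)) ∈ L'.lattice := by
        rw [hmZ, ← mul_assoc]; exact (hmem'' z).mp hz''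
      have hΨ : (L'.curve.ΨSq m).eval (℘[L'] ((β : ℂ) * (z : ℂ))) = 0 :=
        (L'.eval_ΨSq_weierstrassP_eq_zero_iff huΛ' m).mpr hmu
      rw [hQ, hΨ]; ring
    · -- generic point: transformation, homogeneity and multiplication by `m`
      have hmu : ((m : ℤ) : ℂ) * ((β : ℂ) * (z : ℂ)) ∉ L'.lattice := by
        rw [hmZ, ← mul_assoc]; exact fun h ↦ hz'' ((hmem'' z).mpr h)
      have h1 := hPQ z hz''
      have h2 := L'.weierstrassP_int_mul_mul_ΨSq huΛ' hmu
      rw [h℘'' z, mul_assoc (m : ℂ) (β : ℂ) (z : ℂ), ← hmZ] at h1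
      linear_combination ((m : ℂ) * β) ^ 2 * (Q₀.map (algebraMap ℚ ℂ)).eval (℘[L] ↑z) * h2 -
        (L'.curve.ΨSq m).eval (℘[L'] (↑β * ↑z)) * h1
  have h := ofReal_aeval_F P₀ Q₀ (W.ΨSq m) (W.Φ m) k x (Φ x)
  rw [key] at h
  exact_mod_cast h

end Summit.KontsevichZagierPeriods.IsogenyCertificates.RealPeriodSectorCompleteStubs.DividedIsogenyCurve

end
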